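import Summits.CriticalPhenomena.CardyFormulaZ2.Theorems.CardyComplexConeEdgePrecompactEnvelopeFromLocal
import Literature.Probability.Percolation.FourArmGarbanShift
import Literature.Probability.Percolation.QuadCrossingDiscreteGluingGarban
import Literature.Probability.LatticeModels.MedialWindingBridge

/-!
# Line `annulus-surgery-shift` for crux `CardyComplexCone.EdgePrecompact` (stmt-CriticalPhenomena-11387)

Strategist line (seat `cstrat-…-s2`, 2026-08-17), registered ALONGSIDE the live skeleton
`Lines/qkz_strip_boundary_arm.lean` (lead c5); it shares that line's open core (X1) verbatim and REPLACES its
second open stub `stub_uniformForwardResponseStability` (UFRS: a BOUNDARY shift — the same configuration read in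
the domain `D` and in its translate `D − δw`, whose discrepancy lives in the `η`-collar of `∂D` and needs
half-plane three-arm sums over a box-counting of `∂D`, i.e. for rough Jordan `D` a screening lemma not in print)
by an INTERIOR surgery that never sees `∂D`.

## Idea

Clause (ii) of the crux compares the corner observable at two same-class corners `(v,f)`, `(v+w,f+w)` of the
SAME discrete datum `E = Λ δ` at distance `‖δw‖ < η`.  Couple `P_{1/2}` with itself by a measure-preserving
relabelling `Φ` of the edges ("annulus surgery"): outside the ball `B(δv,(4+4θ)ρ)` the configuration is kept
VERBATIM (so the boundary, the arcs and every exterior excursion of the exploration path are untouched — no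
boundary estimate whatsoever); inside `B(δv,4ρ)` it is TRANSLATED by `w`; the thin collar in between (width
`≍ θρ ≥ ‖δw‖`) is refilled with far-away coins (Hilbert hotel on an infinite row of edges outside `Ω`, as in
`exists_farEdges`).  On the complement of a "neck" event `N` the exploration paths of `ω` and `Φω` visit the same
exterior darts and translated interior darts in the same order, with collar traversals of equal turning, so that
`F_{v,f}(ω) = F_{v+w,f+w}(Φω)` for the spin-`1/3` dart phase sum `F`; hence
`E F_{v,f} − E F_{v+w,f+w} = E[F_{v,f}; N] − E[F_{v+w,f+w}; Φ N]`, both events measurable OFF the balls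
`B(δv,ρ)`, `B(δ(v+w),ρ)` and of probability `→ 0` as `θ → 0` — and (X1) (uniform integrability of the localised
amplitude off a small exterior event) turns this into `≤ ε δ^{1/3}`.  The neck event is a union, over two
ONE-dimensional families of boxes along the collar (collar-size boxes with arms to an intermediate scale `s`,
and `s`-boxes with arms to `ρ/8`), of translates of Garban's polychromatic four-arm event `fourArmTwoClustersAt`;
its probability is `≲ (ρ/s)(θρ/s)^{ε₄} + (s/ρ)^{ε₄}` by the tree's UNCONDITIONAL multi-scale four-arm bound
`QuadCrossing.fourArm_bound : π₄(m,n) ≤ c (m/n)^{1+ε₄}` (Garban, App. B of Schramm–Smirnov 2011, landed in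
`QuadCrossingDiscreteGluingGarban.lean`) — the same summation as Schramm–Smirnov's discrete gluing Theorem 1.1
(landed: `QuadCrossing.discreteGluing_of_finite_inter`), applied to the interface's local phase functional
instead of a crossing event.

## Stubs (3; `EdgePrecompact_of` below is kernel-checked from them, no `sorry` of its own)

* (X1) `stub_localInnerEnvelopeUI` — VERBATIM the registered open core of the live line (shared stub).
* (A)  `stub_ringFourArmBound` — phase-free, CLOSABLE NOW from `QuadCrossing.fourArm_bound`,
  `real_fourArmTwoClustersAt` (translation invariance) and a recentring monotonicity of `fourArmTwoClustersAt`: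
  the union bound over all centres in a sup-norm ring of radius `R` and thickness `2k`:
  `P(⋃_{c : R-k ≤ ‖c-v‖∞ ≤ R+k} fourArmTwoClustersAt c k n) ≤ C (R/k) (k/n)^{1+ε}` (M).
* (T)  `stub_interiorShiftTransport_of_ringFourArmBound` — INTERIOR SHIFT TRANSPORT from (A) (XL; the new
  stub): for `ε' > 0` there is `θ > 0` such that for every admissible datum `E`, corner `(v,f)`, lattice vector
  `w` and radius `ρ` with `E.δ ≤ θρ`, `‖δw‖ ≤ θρ`, `closedBall (δv) (8ρ) ⊆ E.Ω`, the difference of the full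
  expectations of `F_{v,f}` and `F_{v+w,f+w}` is carried by two events `A`, `A'`, measurable off `B(δv,ρ)` resp.
  off `B(δ(v+w),ρ)`, each of probability `≤ ε'`.  Plan: surgery `Φ` as above (measure-preserving: a permutation
  of coordinates of the product measure; `BondConfig.relabel`, `exists_farEdges`); `A := N ∪ Φ⁻¹N'`,
  `A' := Φ A`; the probabilistic input is (A) only; the heart is the DETERMINISTIC transport lemma "if
  `F_{v,f}(ω) ≠ F_{v+w,f+w}(ω'')` for two configurations agreeing verbatim off `B(δv,(4+4θ)ρ)` and by translation
  on `B(δv,4ρ)`, then `ω` or `ω''` has Garban's four-arm event at a collar-size box along the collar out to scale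
  `s`, or at an `s`-box along the collar out to `ρ/8`" (membership of interior edges in the wired cluster / free
  dual cluster changes only through two distinct large clusters meeting a small box — cluster form of the four
  arms, cf. the landed `Quad.resample_mem_fourArm_step`; equal membership forces equal passage data, equal order of
  the common excursions, and equal turning of the collar traversals by the theorem of turning tangents in the cut
  annulus — the lap count being the point to settle first; see the line card).

## Proved here

`boundClause` (clause (i) from `UniformInnerEnvelope`, copied from the live skeleton, lead c2),
`equicontClause_of_transport` (clause (ii) from (X1) + (T): the `ε/3`-bookkeeping of the lead's
`shiftStability_of`, with the two balls `B(δv,ρ)`, `B(δv',ρ)` of the SAME datum in place of the datum and its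
translate), `EdgePrecompact_of`.

Disproof used: F1–F3 (`EdgePrecompact_false_without_*`: interiority of `K`, the mesh normalisation and eventual
admissibility are all consumed by `boundClause`/`equicontClause_of_transport`); F4/F6 (no linear/primitive
structure is claimed; the phase enters only through (X1)); the X1-necessity certificate p128713 is honoured (X1 is
a stub).  `ledger negatives --problem CriticalPhenomena`: no stub is an instance.

References: O. Schramm, S. Smirnov, C. Garban, Ann. Probab. 39 (2011) 1768–1814, Thm. 1.1, §2 and App. B
[SchrammSmirnov2011]; C. Garban, G. Pete, O. Schramm, J. Amer. Math. Soc. 26 (2013) 939–1024, §3 (coupling /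
gluing arguments charged to four-arm events) [arXiv:1008.1378]; H. Duminil-Copin, S. Smirnov, Clay Math. Proc. 15
(2012) §8, Conj. 8.7 [DuminilCopinSmirnov2012].
-/

namespace Summit.CriticalPhenomena.CardyFormulaZ2.Cruxes.EdgePrecompact.AnnulusSurgeryShift

open MeasureTheory Filter Set Metric ProbabilityTheory
open scoped Topology BigOperators Pointwise
open Literature.Probability.LatticeModels Literature.Probability.Percolation
open Literature.Probability.RandomPlanarGeometry (DobrushinDomain)
open Summit.CriticalPhenomena.CardyFormulaZ2.Theses.CardyComplexCone
open Summit.CriticalPhenomena.CardyFormulaZ2.Cruxes.EdgePrecompact.QkzStripBoundaryArm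

set_option linter.unusedVariables false

noncomputable section

/-! ## The probabilistic input of (T) is in the tree -/

/-- Garban's multi-scale four-arm bound for critical bond percolation on `ℤ²`, unconditional in the tree. -/
example : ∃ c ε : ℝ, 0 < c ∧ 0 < ε ∧ ∀ m n : ℕ, 1 ≤ m → m ≤ n →
    (bondPercolation (zdGraph 2) half).real (fourArmTwoClusters m n) ≤ c * ((m : ℝ) / n) ^ (1 + ε) :=
  QuadCrossing.fourArm_bound

/-! ## The stubs -/

/-- **(X1) `stub_localInnerEnvelopeUI` — LOCAL INNER ENVELOPE, uniform-integrability tail form (XL; the shared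
open core of both registered lines, statement VERBATIM the live skeleton's).** For every `ε₁ > 0` there is
`ε' > 0` such that for every admissible datum `E`, corner `(v,f)`, radius `ρ ≥ E.δ` with `closedBall (δv) ρ ⊆ E.Ω`
and every event `A` measurable with respect to the configuration OFF the ball `B(δv, ρ)` with `P(A) ≤ ε'`:
`‖E[F_{v,f} ; A]‖ ≤ ε₁ (E.δ/ρ)^{1/3}`.  Why it might fail: the sharp value `1/3` of the exponent (DCS Conj. 8.7
normalisation at `q = 1`).  Leans on: nothing new here. -/
theorem stub_localInnerEnvelopeUI : ∀ ε₁ > (0:ℝ), ∃ ε' > (0:ℝ), ∀ (E : DiscreteDobrushin), E.IsZdAdmissible → ∀ v f : Site 2, IsCorner v f → ∀ ρ : ℝ, E.δ ≤ ρ → closedBall (meshPoint E.δ v) ρ ⊆ E.Ω → ∀ A : Set (BondConfig (Site 2)), MeasurableSet[MeasurableSpace.comap (fun ω : BondConfig (Site 2) => ω \ {e | medialPoint E.δ e ∈ ball (meshPoint E.δ v) ρ}) (inferInstance : MeasurableSpace (BondConfig (Site 2)))] A → (bondPercolation (zdGraph 2) half).real A ≤ ε' → ‖∫ ω in A, dartPhaseSum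 (medialExploration E ω) E.δ (1 / 3) (v, f) ∂(bondPercolation (zdGraph 2) half)‖ ≤ ε₁ * (E.δ / ρ) ^ ((1:ℝ) / 3) := by
  sorry

/-- **(A) `stub_ringFourArmBound` — the RING UNION BOUND for Garban's four-arm event (M; phase-free; closable now).**
There are `C, ε > 0` such that for every base site `v`, every box size `k ≥ 1`, arm length `n ≥ k` and ring
radius `R ≥ n`: the probability that SOME site `c` of the sup-norm ring `R − k ≤ ‖c − v‖∞ ≤ R + k` carries the
polychromatic four-arm event from `‖· − c‖∞ = k` to `‖· − c‖∞ = n` (cluster form `fourArmTwoClustersAt c k n`)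
is at most `C (R/k) (k/n)^{1+ε}`.  Why plausibly true / plan: cover the ring by `≤ 48 R/k` boxes of a `k`-grid;
for `c` in the grid box of `c'`, `fourArmTwoClustersAt c k n ⊆ fourArmTwoClustersAt c' (2k) (n − k)` (first-exit
restriction of the two crossings to the smaller concentric annulus, as in `mem_fourArmTwoClusters_mono`, recentred);
translation invariance `real_fourArmTwoClustersAt`; the tree's unconditional `QuadCrossing.fourArm_bound`
`π₄(2k, n−k) ≤ c (2k/(n−k))^{1+ε}`; for `n < 2k` the bound is trivial once `C ≥ 4`.  Why it might fail: it does
not (union bound over a proved estimate); stated as a stub because the recentring monotonicity is not yet in the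
tree. -/
theorem stub_ringFourArmBound : ∃ C ε : ℝ, 0 < C ∧ 0 < ε ∧ ∀ (v : Site 2) (k n R : ℕ), 1 ≤ k → k ≤ n → n ≤ R → (bondPercolation (zdGraph 2) half).real (⋃ c ∈ {c : Site 2 | c - v ∈ sqAnnulus (R - k) (R + k)}, fourArmTwoClustersAt c k n) ≤ C * ((R : ℝ) / k) * ((k : ℝ) / n) ^ (1 + ε) := by
  sorry

/-- **(T) `stub_interiorShiftTransport_of_ringFourArmBound` — INTERIOR SHIFT TRANSPORT of the corner observable,
from the ring four-arm bound (XL; the new load-bearing stub of this line; no boundary, no half-plane arm).**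
Given (A): for every `ε' > 0` there is `θ > 0` such that for every admissible datum `E` (ANY bounded domain and
arcs), corner `(v,f)`, lattice vector `w` and radius `ρ > 0` with `E.δ ≤ θρ`, `‖δw‖ ≤ θρ` and
`closedBall (δv) (8ρ) ⊆ E.Ω`, there are events `A`, `A'`, measurable with respect to the configuration OFF the
ball `B(δv,ρ)` resp. OFF `B(δ(v+w),ρ)`, with `P(A), P(A') ≤ ε'`, carrying the difference of the expectations of
the spin-`1/3` dart phase sums at `(v,f)` and at the same-class corner `(v+w,f+w)`:
`E F_{v,f} − E F_{v+w,f+w} = E[F_{v,f}; A] − E[F_{v+w,f+w}; A']`.  Plan (see the module docstring): annulus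
surgery `Φ` (exterior of `B(δv,(4+4θ)ρ)` verbatim, `B(δv,4ρ)` translated by `w`, collar ↔ far coins; a
permutation of coordinates, hence `P_{1/2}`-preserving), `A :=` the neck event of `ω` and of `Φω` (a union over two
one-dimensional families of boxes along the collar of events `fourArmTwoClustersAt`, bounded by (A) with
`(k,n,R) = (16θρ/δ, s/δ, 4ρ/δ)` and `(2s/δ, ρ/(8δ), 4ρ/δ)`, first `s/ρ` then `θρ/s` small), `A' := Φ A`, and the
deterministic transport lemma on the complement.  Why it might fail: the deterministic lemma must also control
the LAP COUNT of the collar traversals (equal cluster membership and equal excursion order give equal turning only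
within the cut annulus); a configuration pair whose interface threads the collar with a different number of laps
and no four-arm neck would force a third family of (two-arm / many-crossing) events into `A`.  Sources:
[SchrammSmirnov2011] Thm 1.1, §2, App. B; [arXiv:1008.1378] §3. -/
theorem stub_interiorShiftTransport_of_ringFourArmBound :
    (∃ C ε : ℝ, 0 < C ∧ 0 < ε ∧ ∀ (v : Site 2) (k n R : ℕ), 1 ≤ k → k ≤ n → n ≤ R → (bondPercolation (zdGraph 2) half).real (⋃ c ∈ {c : Site 2 | c - v ∈ sqAnnulus (R - k) (R + k)}, fourArmTwoClustersAt c k n) ≤ C * ((R : ℝ) / k) * ((k : ℝ) / n) ^ (1 + ε)) →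
    ∀ ε' > (0:ℝ), ∃ θ > (0:ℝ), ∀ (E : DiscreteDobrushin), E.IsZdAdmissible → ∀ v f w : Site 2, IsCorner v f → ∀ ρ : ℝ, 0 < ρ → E.δ ≤ θ * ρ → ‖meshPoint E.δ w‖ ≤ θ * ρ → closedBall (meshPoint E.δ v) (8 * ρ) ⊆ E.Ω → ∃ A A' : Set (BondConfig (Site 2)), MeasurableSet[MeasurableSpace.comap (fun ω : BondConfig (Site 2) => ω \ {e | medialPoint E.δ e ∈ ball (meshPoint E.δ v) ρ}) (inferInstance : MeasurableSpace (BondConfig (Site 2)))] A ∧ MeasurableSet[MeasurableSpace.comap (fun ω : BondConfig (Site 2) => ω \ {e | medialPoint E.δ e ∈ ball (meshPoint E.δ (v + w)) ρ}) (inferInstance : MeasurableSpace (BondConfig (Site 2)))] A' ∧ (bondPercolation (zdGraph 2) half).real A ≤ ε' ∧ (bondPercolation (zdGraph 2) half).real A' ≤ ε' ∧ (∫ ω, dartPhaseSum (medialExploration E ω) E.δ (1 / 3) (v, f) ∂(bondPercolation (zdGraph 2) half)) - (∫ ω, dartPhaseSum (medialExploration E ω) E.δ (1 / 3) (v + w,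 f + w) ∂(bondPercolation (zdGraph 2) half)) = (∫ ω in A, dartPhaseSum (medialExploration E ω) E.δ (1 / 3) (v, f) ∂(bondPercolation (zdGraph 2) half)) - (∫ ω in A', dartPhaseSum (medialExploration E ω) E.δ (1 / 3) (v + w, f + w) ∂(bondPercolation (zdGraph 2) half)) := by
  sorry

/-! ## Proved glue -/

/-- **Clause (i) of the crux from the uniform inner envelope, by compactness** (verbatim the live skeleton's
`boundClause`, lead c2: this is where the interiority of `K` enters, lattice depth `≥ dist(K, Dᶜ)/δ → ∞`). -/
theorem boundClause (hU : QkzStripBoundaryArm.UniformInnerEnvelope) (D : DobrushinDomain) (Λ : ℝ → DiscreteDobrushin)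
    (hΩ : ∀ δ, (Λ δ).Ω = D.carrier) (hδ : ∀ δ, (Λ δ).δ = δ)
    (hadm : ∀ᶠ δ in 𝓝[>] (0:ℝ), (Λ δ).IsZdAdmissible) (K : Set ℂ) (hK : IsCompact K)
    (hKD : K ⊆ D.carrier) :
    ∃ C : ℝ, ∀ᶠ δ in 𝓝[>] (0:ℝ), ∀ v f : Site 2, IsCorner v f → meshPoint δ v ∈ K →
      ‖cornerObs (Λ δ) δ v f‖ ≤ C * δ ^ ((1:ℝ) / 3) := by
  obtain ⟨C, hC⟩ := hU
  obtain ⟨ρ, hρ, hρD⟩ := hK.exists_thickening_subset_open D.isOpen hKD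
  refine ⟨max C 0 * (2 / ρ) ^ ((1:ℝ) / 3), ?_⟩
  have hsmall : ∀ᶠ δ in 𝓝[>] (0:ℝ), δ ∈ Ioo (0:ℝ) (ρ / 2) := Ioo_mem_nhdsGT (by positivity)
  filter_upwards [hadm, hsmall] with δ hδadm hδI
  obtain ⟨hδ0, hδρ⟩ := hδI
  intro v f hvf hvK
  have hDc : D.carrierᶜ.Nonempty := by
    obtain ⟨y, hy⟩ := (Set.ne_univ_iff_exists_notMem _).1 D.toJordanDomain.carrier_ne_univ
    exact ⟨y, hy⟩
  have hdist : ρ ≤ infDist (meshPoint δ v) D.carrierᶜ := by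
    rw [le_infDist hDc]
    intro y hy
    by_contra hlt
    have hlt' : dist (meshPoint δ v) y < ρ := lt_of_not_ge hlt
    have hyb : y ∈ ball (meshPoint δ v) ρ := by
      rw [mem_ball, dist_comm]; exact hlt'
    exact hy (hρD (ball_subset_thickening hvK ρ hyb))
  obtain ⟨R, hR⟩ : ∃ R : ℕ, R = ⌊ρ / δ⌋₊ := ⟨_, rfl⟩
  have hρδ : 2 ≤ ρ / δ := by
    rw [le_div_iff₀ hδ0]; linarith
  have hR1 : 1 ≤ R := by
    rw [hR]
    exact Nat.floor_pos.2 (by linarith)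
  have hRle : (R : ℝ) * δ ≤ ρ := by
    have : (R : ℝ) ≤ ρ / δ := by rw [hR]; exact Nat.floor_le (by positivity)
    rwa [le_div_iff₀ hδ0] at this
  have hRge : ρ / (2 * δ) ≤ (R : ℝ) := by
    have hlt : ρ / δ < (R : ℝ) + 1 := by rw [hR]; exact Nat.lt_floor_add_one _
    have hhalf : ρ / δ = 2 * (ρ / (2 * δ)) := by field_simp
    linarith
  have hx : 0 < ρ / (2 * δ) := by positivity
  have hE : (Λ δ).δ = δ := hδ δ
  have h := hC D (Λ δ) (hΩ δ) hδadm v f hvf R hR1 (by rw [hE]; exact le_trans hRle hdist)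
  rw [hE] at h
  have hexp : (-(1:ℝ) / 3) ≤ 0 := by norm_num
  have hmono : (R : ℝ) ^ (-(1:ℝ) / 3) ≤ (ρ / (2 * δ)) ^ (-(1:ℝ) / 3) :=
    Real.rpow_le_rpow_of_nonpos hx hRge hexp
  have hpow : (ρ / (2 * δ)) ^ (-(1:ℝ) / 3) = (2 / ρ) ^ ((1:ℝ) / 3) * δ ^ ((1:ℝ) / 3) := by
    calc (ρ / (2 * δ)) ^ (-(1:ℝ) / 3) = ((ρ / (2 * δ)) ^ ((1:ℝ) / 3))⁻¹ := by
            rw [show (-(1:ℝ) / 3) = -((1:ℝ) / 3) by ring, Real.rpow_neg hx.le]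
      _ = ((ρ / (2 * δ))⁻¹) ^ ((1:ℝ) / 3) := (Real.inv_rpow hx.le _).symm
      _ = ((2 / ρ) * δ) ^ ((1:ℝ) / 3) := by rw [inv_div]; ring_nf
      _ = (2 / ρ) ^ ((1:ℝ) / 3) * δ ^ ((1:ℝ) / 3) := Real.mul_rpow (by positivity) hδ0.le
  have hr0 : 0 ≤ (R : ℝ) ^ (-(1:ℝ) / 3) := Real.rpow_nonneg (by positivity) _
  calc ‖cornerObs (Λ δ) δ v f‖ ≤ C * (R : ℝ) ^ (-(1:ℝ) / 3) := h
    _ ≤ max C 0 * (R : ℝ) ^ (-(1:ℝ) / 3) := mul_le_mul_of_nonneg_right (le_max_left _ _) hr0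
    _ ≤ max C 0 * (ρ / (2 * δ)) ^ (-(1:ℝ) / 3) := mul_le_mul_of_nonneg_left hmono (le_max_right _ _)
    _ = max C 0 * (2 / ρ) ^ ((1:ℝ) / 3) * δ ^ ((1:ℝ) / 3) := by rw [hpow]; ring

/-- **Clause (ii) of the crux from (X1) + interior shift transport.** For `ε > 0` and a compact `K` with
`cthickening r K ⊆ D` take `ρ = r/8`, `ε₁ = ε ρ^{1/3}/2`, `ε'` from (X1) at `ε₁`, `θ` from (T) at `ε'`,
`η = θρ`; eventually `δ < min(θρ, ρ)` and `Λ δ` is admissible.  For same-class corners `(v,f)`, `(v',f')` in `K`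
at distance `< η` write `(v',f') = (v+w, f+w)`, `‖δw‖ = dist(δv, δv') < θρ`; (T) carries the difference of the
two full expectations onto `A` (off `B(δv,ρ)`) and `A'` (off `B(δv',ρ)`), and (X1) bounds each restricted
expectation by `ε₁ (δ/ρ)^{1/3}` (both balls lie in `D` since `δv, δv' ∈ K`). -/
theorem equicontClause_of_transport
    (hUI : ∀ ε₁ > (0:ℝ), ∃ ε' > (0:ℝ), ∀ (E : DiscreteDobrushin), E.IsZdAdmissible → ∀ v f : Site 2, IsCorner v f → ∀ ρ : ℝ, E.δ ≤ ρ → closedBall (meshPoint E.δ v) ρ ⊆ E.Ω → ∀ A : Set (BondConfig (Site 2)), MeasurableSet[MeasurableSpace.comap (fun ω : BondConfig (Site 2) => ω \ {e | medialPoint E.δ e ∈ ball (meshPoint E.δ v) ρ}) (inferInstance : MeasurableSpace (BondConfig (Site 2)))] A → (bondPercolation (zdGraph 2) half).real A ≤ ε' → ‖∫ ω in A, dartPhaseSum (medialExploration E ω) E.δ (1 / 3) (v, f) ∂(bondPercolation (zdGraph 2) half)‖ ≤ ε₁ * (E.δ / ρ) ^ ((1:ℝ) / 3))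
    (hT : ∀ ε' > (0:ℝ), ∃ θ > (0:ℝ), ∀ (E : DiscreteDobrushin), E.IsZdAdmissible → ∀ v f w : Site 2, IsCorner v f → ∀ ρ : ℝ, 0 < ρ → E.δ ≤ θ * ρ → ‖meshPoint E.δ w‖ ≤ θ * ρ → closedBall (meshPoint E.δ v) (8 * ρ) ⊆ E.Ω → ∃ A A' : Set (BondConfig (Site 2)), MeasurableSet[MeasurableSpace.comap (fun ω : BondConfig (Site 2) => ω \ {e | medialPoint E.δ e ∈ ball (meshPoint E.δ v) ρ}) (inferInstance : MeasurableSpace (BondConfig (Site 2)))] A ∧ MeasurableSet[MeasurableSpace.comap (fun ω : BondConfig (Site 2) => ω \ {e | medialPoint E.δ e ∈ ball (meshPoint E.δ (v + w)) ρ}) (inferInstance : MeasurableSpace (BondConfig (Site 2)))] A' ∧ (bondPercolation (zdGraph 2) half).real A ≤ ε' ∧ (bondPercolation (zdGraph 2) half).real A' ≤ ε' ∧ (∫ ω, dartPhaseSum (medialExploration E ω) E.δ (1 / 3) (v, f) ∂(bondPercolation (zdGraph 2) half)) - (∫ ω, dartPhaseSum (medialExploration E ω) E.δ (1 / 3) (v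 + w, f + w) ∂(bondPercolation (zdGraph 2) half)) = (∫ ω in A, dartPhaseSum (medialExploration E ω) E.δ (1 / 3) (v, f) ∂(bondPercolation (zdGraph 2) half)) - (∫ ω in A', dartPhaseSum (medialExploration E ω) E.δ (1 / 3) (v + w, f + w) ∂(bondPercolation (zdGraph 2) half)))
    (D : DobrushinDomain) (Λ : ℝ → DiscreteDobrushin)
    (hΩ : ∀ δ, (Λ δ).Ω = D.carrier) (hδ : ∀ δ, (Λ δ).δ = δ)
    (hadm : ∀ᶠ δ in 𝓝[>] (0:ℝ), (Λ δ).IsZdAdmissible) (K : Set ℂ) (hK : IsCompact K)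
    (hKD : K ⊆ D.carrier) :
    ∀ ε > (0:ℝ), ∃ η > (0:ℝ), ∀ᶠ δ in 𝓝[>] (0:ℝ), ∀ v f v' f' : Site 2,
      IsCorner v f → IsCorner v' f' → f - v = f' - v' → meshPoint δ v ∈ K → meshPoint δ v' ∈ K →
      dist (meshPoint δ v) (meshPoint δ v') < η →
      ‖cornerObs (Λ δ) δ v f - cornerObs (Λ δ) δ v' f'‖ ≤ ε * δ ^ ((1:ℝ) / 3) := by
  intro ε hε
  -- a uniform room radius for `K` (interiority of `K` is load-bearing)
  obtain ⟨r, hr, hrK⟩ := hK.exists_cthickening_subset_open D.isOpen hKD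
  set ρ : ℝ := r / 8 with hρdef
  have hρ : 0 < ρ := by positivity
  have h8ρ : 8 * ρ = r := by rw [hρdef]; ring
  have hballK : ∀ (δ : ℝ) (v : Site 2), meshPoint δ v ∈ K →
      closedBall (meshPoint δ v) (8 * ρ) ⊆ D.carrier := fun δ v hvK x hx =>
    hrK (mem_cthickening_of_dist_le x (meshPoint δ v) r K hvK (by rw [← h8ρ]; exact mem_closedBall.1 hx))
  have hballK' : ∀ (δ : ℝ) (v : Site 2), meshPoint δ v ∈ K →
      closedBall (meshPoint δ v) ρ ⊆ D.carrier := fun δ v hvK =>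
    (closedBall_subset_closedBall (by linarith)).trans (hballK δ v hvK)
  -- constants
  set ε₁ : ℝ := ε * ρ ^ ((1:ℝ) / 3) / 2 with hε₁def
  have hε₁ : 0 < ε₁ := by positivity
  obtain ⟨ε', hε', hC⟩ := hUI ε₁ hε₁
  obtain ⟨θ, hθ, hTθ⟩ := hT ε' hε'
  refine ⟨θ * ρ, by positivity, ?_⟩
  have hpos : ∀ᶠ δ in 𝓝[>] (0:ℝ), 0 < δ := eventually_mem_nhdsWithin
  have hltθ : ∀ᶠ δ in 𝓝[>] (0:ℝ), δ < θ * ρ :=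
    (eventually_lt_nhds (by positivity)).filter_mono nhdsWithin_le_nhds
  have hltρ : ∀ᶠ δ in 𝓝[>] (0:ℝ), δ < ρ := (eventually_lt_nhds hρ).filter_mono nhdsWithin_le_nhds
  filter_upwards [hadm, hpos, hltθ, hltρ] with δ hadmδ hδpos hδθ hδρ
  intro v f v' f' hvf hv'f' hclass hvK hv'K hdist
  have hΛδ : (Λ δ).δ = δ := hδ δ
  -- the same-class partner is the translate by the lattice vector `w := v' - v`
  set w : Site 2 := v' - v with hwdef
  have e1 : v + w = v' := by rw [hwdef]; abel
  have e2 : f + w = f' := by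
    calc f + w = (f - v) + v' := by rw [hwdef]; abel
      _ = (f' - v') + v' := by rw [hclass]
      _ = f' := sub_add_cancel f' v'
  have hcor' : IsCorner (v + w) (f + w) := by rw [e1, e2]; exact hv'f'
  have hnormw : ‖meshPoint δ w‖ ≤ θ * ρ := by
    have hmw : meshPoint δ w = meshPoint δ v' - meshPoint δ v := by
      have h := meshPoint_add_shift δ v w
      rw [e1] at h
      rw [h]; ring
    rw [hmw, ← dist_eq_norm, dist_comm]
    exact hdist.le
  -- (T): the difference is carried by `A` (off `B(δv,ρ)`) and `A'` (off `B(δv',ρ)`)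
  obtain ⟨A, A', hA, hA', hPA, hPA', hId⟩ := hTθ (Λ δ) hadmδ v f w hvf ρ hρ
    (by rw [hΛδ]; exact hδθ.le) (by rw [hΛδ]; exact hnormw) (by rw [hΛδ, hΩ]; exact hballK δ v hvK)
  rw [hΛδ] at hA hA' hId
  -- (X1) on `A` at the corner `(v,f)` …
  have key₀ := hC (Λ δ) hadmδ v f hvf ρ (by rw [hΛδ]; exact hδρ.le)
    (by rw [hΛδ, hΩ]; exact hballK' δ v hvK) A (by rw [hΛδ]; exact hA) hPA
  rw [hΛδ] at key₀
  -- … and on `A'` at the corner `(v+w, f+w) = (v', f')`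
  have key₁ := hC (Λ δ) hadmδ (v + w) (f + w) hcor' ρ (by rw [hΛδ]; exact hδρ.le)
    (by rw [hΛδ, hΩ, e1]; exact hballK' δ v' hv'K) A' (by rw [hΛδ]; exact hA') hPA'
  rw [hΛδ] at key₁
  -- assemble
  rw [← e1, ← e2, cornerObs_eq_integral_dartPhaseSum, cornerObs_eq_integral_dartPhaseSum, hId]
  have hsplit : (δ / ρ) ^ ((1:ℝ) / 3) = δ ^ ((1:ℝ) / 3) / ρ ^ ((1:ℝ) / 3) :=
    Real.div_rpow hδpos.le hρ.le _
  have hρ3 : 0 < ρ ^ ((1:ℝ) / 3) := Real.rpow_pos_of_pos hρ _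
  calc ‖(∫ ω in A, dartPhaseSum (medialExploration (Λ δ) ω) δ (1 / 3) (v, f)
            ∂(bondPercolation (zdGraph 2) half)) -
          (∫ ω in A', dartPhaseSum (medialExploration (Λ δ) ω) δ (1 / 3) (v + w, f + w)
            ∂(bondPercolation (zdGraph 2) half))‖
      ≤ ‖∫ ω in A, dartPhaseSum (medialExploration (Λ δ) ω) δ (1 / 3) (v, f)
            ∂(bondPercolation (zdGraph 2) half)‖ +
          ‖∫ ω in A', dartPhaseSum (medialExploration (Λ δ) ω) δ (1 / 3) (v + w, f + w)
            ∂(bondPercolation (zdGraph 2) half)‖ := norm_sub_le _ _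
    _ ≤ ε₁ * (δ / ρ) ^ ((1:ℝ) / 3) + ε₁ * (δ / ρ) ^ ((1:ℝ) / 3) := add_le_add key₀ key₁
    _ = ε * δ ^ ((1:ℝ) / 3) := by
        rw [hsplit, hε₁def]
        field_simp
        ring

/-! ## The composition (kernel-checked, no `sorry` of its own) -/

/-- **`EdgePrecompact` from the three stubs.** Clause (i): (X1) gives `UniformInnerEnvelope` (landed thinning
`uniformInnerEnvelope_of_localInnerEnvelopeUI`), then `boundClause`.  Clause (ii): `equicontClause_of_transport`
fed with (X1) and the interior shift transport (T) applied to the ring four-arm bound (A).  The crux's `E δ v f`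
is `cornerObs (Λ δ) δ v f` by `rfl`. -/
theorem EdgePrecompact_of : EdgePrecompact := by
  intro D Λ hΩ hδ hadm E K hK hKD
  -- the crux's `E δ v f` is `cornerObs (Λ δ) δ v f` up to the two copies of the polyline winding
  -- (`LatticeModels.winding` in the route file, `Polyline.winding` in `cornerObs`; bridge lemma
  -- `Polyline.winding_eq_winding'` of `MedialWindingBridge.lean`)
  have key : ∀ (δ : ℝ) (v f : Site 2), E δ v f = cornerObs (Λ δ) δ v f := fun δ v f => by
    simp only [E, cornerObs, Literature.Probability.LatticeModels.Polyline.winding_eq_winding']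
  simp only [key]
  exact ⟨boundClause (uniformInnerEnvelope_of_localInnerEnvelopeUI stub_localInnerEnvelopeUI) D Λ hΩ hδ hadm K hK hKD,
    equicontClause_of_transport stub_localInnerEnvelopeUI
      (stub_interiorShiftTransport_of_ringFourArmBound stub_ringFourArmBound) D Λ hΩ hδ hadm K hK hKD⟩

end

end Summit.CriticalPhenomena.CardyFormulaZ2.Cruxes.EdgePrecompact.AnnulusSurgeryShift
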